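/-
Copyright (c) 2026 the pub-hodgecm-mathlib formalisation cell (harness21).  Prover seat hodgecm-mathlib-K2E3-p03 (g6), Track B «K2-LIT» ∕ h413
(`stmt-HodgeConjecture-24833`), leaf (nsc-S-A′) «principal-block standard span», H-layer brick STD-EMB (dealer K2E3-plan (g4) D89∕D91, architect
K2E3-p25 (g2) `MEMO-SA-architecture.v2` §1 row STD-EMB): THE STANDARD MODULE `D(η, ψ) = Ind_{P₂₁}(η∘det₂ ⊠ ψ)` EMBEDS PROPERLY INTO THE PRINCIPAL SERIES
`I(ην^{-1∕2}, ην^{1∕2}, ψ)` OF `GL₃(F)`.  2026-09-04.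
-/
import Summits.HodgeConjecture.HodgeConjecture.Theorems.K2E3GL3InductionInStagesEmbedding   -- ★ E2-I (K2E3-p14): `monotone_twoOne`, `det_leviProjection_twoOne_true`, `toFun_eq_apply_toFun_one`, `toFun_parabolicIndGL_apply`
import Summits.HodgeConjecture.HodgeConjecture.Theorems.K2E3GL3CharacterJacquetExponent      -- ★ ONE-DIM (K2E3-p25): `coe_det_leviProjection`, `det_coe_borel_eq_prod_det_leviProjection`, `coe_normAbs_units_ne_zero`
import Summits.HodgeConjecture.HodgeConjecture.Theorems.K2E3GL3CuspidalBlockRestriction       -- ★ (K2E3-p21): `rootDeltaChar_eq_one_of_transvectionUnit`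
import Summits.HodgeConjecture.HodgeConjecture.Theorems.K2E3GL3MaximalParabolicRelabel        -- ★ (K2E3-p21): `permGL_rev_mul_transvectionUnit_one_two_mul_inv`, `transvectionUnit_apply`
import Literature.NumberTheory.Automorphic.SmoothInductionParabolicNontrivial                  -- ★ `toFun_cellSection_w₀`, `isOpen∕isCompact_comap_congruenceGL_oppositeCellRadical`
import Literature.NumberTheory.Automorphic.ParabolicGLProofs                                   -- ★ `Representation.isAdmissible_parabolicIndGL_holds`
import Literature.NumberTheory.Automorphic.SmoothCharacterOfCharacter                          -- ★ `isAdmissible_trivial_twist`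
import Literature.NumberTheory.Automorphic.TateLocalFactors                                    -- ★ `unramifiedTwist` (`ν^s = ‖·‖^s`), `unramifiedTwist_apply`
import Literature.NumberTheory.Automorphic.LocalLanglandsGLProofs                              -- ★ `isOpen_ker_quasiChar_holds`
import Literature.NumberTheory.GaloisRepresentations.LocalExistenceLubinTate                   -- ★ `exists_isUniformizer`
import HarnessLib

/-!
# K2_E3 road (h413), leaf (nsc-S-A′), H-layer brick STD-EMB — `D(η,ψ) ↪ I(ην^{-1∕2}, ην^{1∕2}, ψ)`, injective and NOT surjective

Cell `pub/hodgecm-mathlib` (D-0151), Track B, seat K2E3-p03 (g6); architecture K2E3-p25 (g2) `MEMO-SA-architecture.v2` (§0 currency, §1 row STD-EMB).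
`--supports stmt-HodgeConjecture-24833 --as helper`; THEOREMS ONLY (everything inline, no definitions); COUNT-NEUTRAL.

CURRENCY (architect's §0, spelled inline): `M_Q := Π a : Bool, GL {i : Fin 3 // ![false,false,true] i = a} F` (Levi `GL₂ × GL₁` of
`Q = P₂₁ = standardParabolicGL F ![false,false,true]`), `ψ_Q η ψ := (η ∘ det ∘ ev_false) · (ψ ∘ det ∘ ev_true) : M_Q →* ℂ^×`,
`D η ψ := parabolicIndGL F ![false,false,true] (𝟙.twist (ψ_Q η ψ))` (normalised induction of the character `η(det m₂) ψ(m₁)` of `M_Q`),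
`ν½ := (unramifiedTwist F (1/2)).toMonoidHom` (`ν½ x = ‖x‖^{1∕2}`), `tch θ := ∏ a, (θ a) ∘ det ∘ ev_a`, `I θ := parabolicIndGL F id (𝟙.twist (tch θ))`,
`θ := ![η * ν½⁻¹, η * ν½, ψ]`.

THE MATHEMATICS ([BernsteinZelevinsky1977, Prop. 1.9, §2.3 (induction in stages, exactness)]; [Zelevinsky1980, §1, Prop. 2.10 and Ex. 3.2];
[Bump1997, §4.5]).  `η ∘ det₂` is the subrepresentation of `Ind_{B₂}^{GL₂}(ην^{-1∕2} ⊗ ην^{1∕2} ⊗ δ_{B₂}^{1∕2})` consisting of the functions constant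
on `GL₂`; inducing along `Q` gives `D(η,ψ) ⊂ Ind_Q(I₂ ⊠ ψ) = I(θ)`.  Concretely, since `B ≤ Q` and the two inducing characters AGREE on `B`
(`δ_Q^{1∕2}(b) η(b₀₀b₁₁) ψ(b₂₂) = δ_B^{1∕2}(b) · η(b₀₀)‖b₀₀‖^{-1∕2} · η(b₁₁)‖b₁₁‖^{1∕2} · ψ(b₂₂)`, i.e. `‖b₀₀b₁₁‖^{1∕2}‖b₂₂‖⁻¹ = ‖b₀₀‖‖b₂₂‖⁻¹ ·
‖b₀₀‖^{-1∕2}‖b₁₁‖^{1∕2}`, ★ `rootDeltaChar_standardParabolicGL_bool` ∕ ★ `rootDeltaChar_borel_three`), every `f ∈ D(η,ψ)` IS an element of `I(θ)`: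
`Φ f = f` as functions on `GL₃(F)` (formally: Frobenius reciprocity ★ `frobeniusInv` applied to `f ↦ f(1)`).  `Φ` is injective (same function) and
NOT surjective: every `f ∈ D` is left-invariant under the unipotent `u₁₀(x)` of the Levi `GL₂` (`ψ_Q` and `δ_Q^{1∕2}` are trivial on it), whereas the
open-cell standard section `f₀ = Φ_{K,1} ∈ I(θ)` (★ `cellSection`, `K = N′ ∩ K_1`) has `f₀(w₀) = 1` but `f₀(u₁₀(ϖ⁻¹) w₀) = f₀(w₀ u₁₂(ϖ⁻¹)) = 0`
because `u₁₂(ϖ⁻¹) ∉ K_1`.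

§1 `inducing_scalar_borel_eq` (block bookkeeping on `B ≤ Q`); §2 `isOpen_ker_psiQ`, `isAdmissible_D`; §3 `toFun_transvectionUnit_one_zero_mul`
(`f(u₁₀(x) g) = f(g)` on `D(η,ψ)`); §4 **`exists_injective_not_surjective_intertwiningMap`** (`Φ : D(η,ψ) ↪ I(θ)`, not onto, `(Φ f)(g) = f(g)`).
HONEST LABEL: HC_CM is proved only modulo the 7 printed citations (2 remaining named inputs: hLiu418 = stmt-HodgeConjecture-24832, h413 =
stmt-HodgeConjecture-24833) until rung 0 closes; count-neutral helper.

References: [BernsteinZelevinsky1977] Bernstein–Zelevinsky, *Induced representations of reductive 𝔭-adic groups I*, Ann. Sci. ÉNS 10 (1977), Prop. 1.9,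
§2.3 · [Zelevinsky1980] Zelevinsky, *Induced representations II*, Ann. Sci. ÉNS 13 (1980), §1, Prop. 2.10, Ex. 3.2 · [BernsteinZelevinskyRMS1976]
Bernstein–Zelevinsky, *Representations of GL(n,F)*, Russian Math. Surveys 31 (1976), §2.22 · [Bump1997] Bump, *Automorphic Forms and Representations*, §4.5.
-/

set_option autoImplicit false
set_option linter.dupNamespace false

noncomputable section

open scoped MatrixGroups NNReal
namespace Summit.HodgeConjecture.HodgeConjecture.Cruxes.H413.K2E3GL3StandardModuleEmbedding

open ValuativeRel
open Literature.NumberTheory.Automorphic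
open Literature.NumberTheory.GaloisRepresentations Literature.NumberTheory.GaloisRepresentations.IsNonarchimedeanLocalField
open K2E3GL3InductionInStagesEmbedding (monotone_twoOne det_leviProjection_twoOne_true toFun_eq_apply_toFun_one toFun_parabolicIndGL_apply)
open K2E3GL3CharacterJacquetExponent (coe_det_leviProjection det_coe_borel_eq_prod_det_leviProjection coe_normAbs_units_ne_zero)

/-! ## §1 Block bookkeeping on `B ≤ Q = P₂₁` and the agreement of the inducing characters on `B` -/

section Blocks

variable {R : Type*} [CommRing R]

/-- The matrix of the `a`-th Levi block of `p ∈ P_c` is the square block `p|_{c = a}`. [cite: BernsteinZelevinsky1977, §2.1] -/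
theorem coe_leviProjection_eq_toSquareBlock {n : Type*} [Fintype n] [DecidableEq n] {α : Type*} [LinearOrder α] (c : n → α)
    (p : ↥(standardParabolicGL R c)) (a : α) :
    ((leviProjection R c p a : GL {i // c i = a} R) : Matrix {i // c i = a} {i // c i = a} R) = ((p : GL n R) : Matrix n n R).toSquareBlock c a :=
  Matrix.ext fun _ _ => rfl

/-- `det q = det(q|_{GL₂}) · det(q|_{GL₁})` for `q ∈ P₂₁` (block-triangular determinant). [cite: BernsteinZelevinsky1977, §2.1] -/
theorem det_leviProjection_false_mul_true (q : ↥(standardParabolicGL R (![false, false, true] : Fin 3 → Bool))) :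
    Matrix.GeneralLinearGroup.det (leviProjection R (![false, false, true] : Fin 3 → Bool) q false) *
        Matrix.GeneralLinearGroup.det (leviProjection R (![false, false, true] : Fin 3 → Bool) q true) =
      Matrix.GeneralLinearGroup.det (q : GL (Fin 3) R) := by
  apply Units.ext
  rw [Units.val_mul, Matrix.GeneralLinearGroup.val_det_apply, Matrix.GeneralLinearGroup.val_det_apply, Matrix.GeneralLinearGroup.val_det_apply,
    (blockTriangular_of_mem q).det_fintype, Fintype.prod_bool, coe_leviProjection_eq_toSquareBlock, coe_leviProjection_eq_toSquareBlock, mul_comm]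

end Blocks

section Scalar

variable {F : Type} [Field F] [ValuativeRel F] [TopologicalSpace F] [IsNonarchimedeanLocalField F]

omit [ValuativeRel F] [TopologicalSpace F] [IsNonarchimedeanLocalField F] in
/-- For `b ∈ B ≤ P₂₁`: `det(b|_{GL₂}) = b₀₀ · b₁₁` as units, in terms of the torus blocks of `b`. [cite: BernsteinZelevinsky1977, §2.1] -/
theorem det_leviProjection_false_borel (b : ↥(standardParabolicGL F (id : Fin 3 → Fin 3))) :
    Matrix.GeneralLinearGroup.det (leviProjection F (![false, false, true] : Fin 3 → Bool)
        ⟨(b : GL (Fin 3) F), borel_le_standardParabolicGL monotone_twoOne b.2⟩ false) =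
      Matrix.GeneralLinearGroup.det (leviProjection F (id : Fin 3 → Fin 3) b 0) * Matrix.GeneralLinearGroup.det (leviProjection F (id : Fin 3 → Fin 3) b 1) := by
  have h22 := K2E3GL3BorelModulus.diag_ne_zero_of_mem_borel b 2
  have h := congrArg (fun u : Fˣ => (u : F)) (det_leviProjection_false_mul_true
    (⟨(b : GL (Fin 3) F), borel_le_standardParabolicGL monotone_twoOne b.2⟩ : ↥(standardParabolicGL F (![false, false, true] : Fin 3 → Bool))))
  simp only [Units.val_mul] at h
  rw [det_leviProjection_twoOne_true, Matrix.GeneralLinearGroup.val_det_apply] at h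
  change _ * ((b : GL (Fin 3) F) : Matrix (Fin 3) (Fin 3) F) 2 2 = ((b : GL (Fin 3) F) : Matrix (Fin 3) (Fin 3) F).det at h
  rw [K2E3GL3BorelModulus.det_coe_eq_prod_diag, Fin.prod_univ_three] at h
  apply Units.ext
  rw [Units.val_mul, coe_det_leviProjection b 0, coe_det_leviProjection b 1]
  exact mul_right_cancel₀ h22 h


omit [ValuativeRel F] [TopologicalSpace F] [IsNonarchimedeanLocalField F] in
/-- For `b ∈ B ≤ P₂₁`: `det(b|_{GL₁}) = b₂₂` as units (the last torus block). [cite: BernsteinZelevinsky1977, §2.1] -/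
theorem det_leviProjection_true_borel (b : ↥(standardParabolicGL F (id : Fin 3 → Fin 3))) :
    Matrix.GeneralLinearGroup.det (leviProjection F (![false, false, true] : Fin 3 → Bool)
        ⟨(b : GL (Fin 3) F), borel_le_standardParabolicGL monotone_twoOne b.2⟩ true) =
      Matrix.GeneralLinearGroup.det (leviProjection F (id : Fin 3 → Fin 3) b 2) := by
  apply Units.ext
  rw [det_leviProjection_twoOne_true, coe_det_leviProjection b 2]

/-- `ν½(x) = ‖x‖^{1∕2}` (as a complex number) for `ν½ = unramifiedTwist F (1/2)`. [cite: Zelevinsky1980, §1.1] -/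
theorem coe_nuHalf_apply (x : Fˣ) :
    (((((unramifiedTwist F (1 / 2) : QuasiChar F).toMonoidHom) x : ℂˣ)) : ℂ) = (((normAbs F (x : F) : ℝ≥0) : ℝ) : ℂ) ^ ((1 / 2 : ℂ)) := by
  change ((unramifiedTwist F (1 / 2) x : ℂˣ) : ℂ) = _
  rw [unramifiedTwist_apply]

/-- `‖x‖^{1∕2} · ‖x‖^{1∕2} = ‖x‖` in `ℂ`. [cite: Zelevinsky1980, §1.1] -/
theorem normAbs_cpow_half_mul_self (x : F) :
    (((normAbs F x : ℝ≥0) : ℝ) : ℂ) ^ ((1 / 2 : ℂ)) * (((normAbs F x : ℝ≥0) : ℝ) : ℂ) ^ ((1 / 2 : ℂ)) = (((normAbs F x : ℝ≥0) : ℝ) : ℂ) := by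
  by_cases hx : (((normAbs F x : ℝ≥0) : ℝ) : ℂ) = 0
  · rw [hx, Complex.zero_cpow (by norm_num), zero_mul]
  · rw [← Complex.cpow_add _ _ hx, add_halves, Complex.cpow_one]

/-- `√r = r^{1∕2}`: the real square root of `r : ℝ≥0`, coerced to `ℂ`, is the principal complex power. [folklore] -/
theorem coe_sqrt_eq_cpow_half (r : ℝ≥0) : (((NNReal.sqrt r : ℝ≥0) : ℝ) : ℂ) = (((r : ℝ≥0) : ℝ) : ℂ) ^ ((1 / 2 : ℂ)) := by
  rw [Real.coe_sqrt, Real.sqrt_eq_rpow, Complex.ofReal_cpow (NNReal.coe_nonneg r)]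
  norm_num

variable (η ψ : Fˣ →* ℂˣ)

/-- **THE INDUCING CHARACTERS AGREE ON `B`.**  For `b ∈ B ≤ P₂₁` and `θ = (ην^{-1∕2}, ην^{1∕2}, ψ)`:
`δ_{P₂₁}^{1∕2}(b) · η(det b|_{GL₂}) ψ(b₂₂) · c = δ_B^{1∕2}(b) · tch θ (b|_T) · c`, i.e.
`‖b₀₀b₁₁‖^{1∕2}‖b₂₂‖⁻¹ · η(b₀₀b₁₁) ψ(b₂₂) = ‖b₀₀‖‖b₂₂‖⁻¹ · η(b₀₀)‖b₀₀‖^{-1∕2} η(b₁₁)‖b₁₁‖^{1∕2} ψ(b₂₂)`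
(★ `rootDeltaChar_standardParabolicGL_bool`, ★ `rootDeltaChar_borel_three`).  This is the restriction to `B` of the inducing datum of `D(η,ψ)`
versus the inducing character of `I(θ)` — the reason `D(η,ψ) ⊂ I(θ)` as spaces of functions. [cite: BernsteinZelevinsky1977, 1.7, Prop. 1.9, §2.3]
[cite: Zelevinsky1980, Prop. 2.10, Ex. 3.2] -/
theorem inducing_scalar_borel_eq (b : ↥(standardParabolicGL F (id : Fin 3 → Fin 3))) (c : ℂ) :
    ((rootDeltaChar (standardParabolicGL F (![false, false, true] : Fin 3 → Bool)) (⟨(b : GL (Fin 3) F), borel_le_standardParabolicGL monotone_twoOne b.2⟩ : ↥(standardParabolicGL F (![false, false, true] : Fin 3 → Bool))) : ℂˣ) : ℂ) *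
        (((((η.comp (Matrix.GeneralLinearGroup.det.comp (Pi.evalMonoidHom (fun a : Bool => GL {i : Fin 3 // (![false, false, true] : Fin 3 → Bool) i = a} F) false))) * (ψ.comp (Matrix.GeneralLinearGroup.det.comp (Pi.evalMonoidHom (fun a : Bool => GL {i : Fin 3 // (![false, false, true] : Fin 3 → Bool) i = a} F) true))))
            (leviProjection F (![false, false, true] : Fin 3 → Bool) (⟨(b : GL (Fin 3) F), borel_le_standardParabolicGL monotone_twoOne b.2⟩ : ↥(standardParabolicGL F (![false, false, true] : Fin 3 → Bool)))) : ℂˣ) : ℂ) * c) =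
      ((rootDeltaChar (standardParabolicGL F (id : Fin 3 → Fin 3)) b : ℂˣ) : ℂ) *
        (((((∏ a : Fin 3, ((![η * ((unramifiedTwist F (1 / 2) : QuasiChar F).toMonoidHom)⁻¹, η * ((unramifiedTwist F (1 / 2) : QuasiChar F).toMonoidHom), ψ] : Fin 3 → (Fˣ →* ℂˣ)) a).comp (Matrix.GeneralLinearGroup.det.comp (Pi.evalMonoidHom (fun a : Fin 3 => GL {i : Fin 3 // (id : Fin 3 → Fin 3) i = a} F) a)))
            (leviProjection F (id : Fin 3 → Fin 3) b)) : ℂˣ) : ℂ) * c) := by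
  have hcard1 : Fintype.card {i : Fin 3 // (![false, false, true] : Fin 3 → Bool) i = true} = 1 := by decide
  have hcard2 : Fintype.card {i : Fin 3 // (![false, false, true] : Fin 3 → Bool) i = false} = 2 := by decide
  have h0 := normAbs_units_ne_zero (Matrix.GeneralLinearGroup.det (leviProjection F (id : Fin 3 → Fin 3) b 0))
  have h2 := normAbs_units_ne_zero (Matrix.GeneralLinearGroup.det (leviProjection F (id : Fin 3 → Fin 3) b 2))
  rw [rootDeltaChar_standardParabolicGL_bool, hcard1, hcard2, K2E3GL3BorelModulus.rootDeltaChar_borel_three, ← coe_det_leviProjection b 0,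
    ← coe_det_leviProjection b 2, det_leviProjection_false_borel, det_leviProjection_true_borel, MonoidHom.finsetProd_apply, Fin.prod_univ_three]
  simp only [MonoidHom.coe_comp, Function.comp_apply, Pi.evalMonoidHom_apply, Matrix.cons_val_zero, Matrix.cons_val_one, Matrix.cons_val_two,
    Matrix.head_cons, Matrix.tail_cons, MonoidHom.mul_apply, MonoidHom.inv_apply, Units.val_mul, Units.val_inv_eq_inv_val, map_mul,
    det_leviProjection_false_borel, det_leviProjection_true_borel, coe_nuHalf_apply, ← coe_sqrt_eq_cpow_half, pow_one, NNReal.sqrt_mul,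
    NNReal.sqrt_inv, NNReal.sqrt_sq, NNReal.coe_mul, NNReal.coe_inv, Complex.ofReal_mul, Complex.ofReal_inv]
  -- `‖b₀₀‖ = (‖b₀₀‖^{1∕2})²`
  have hsA : NNReal.sqrt (normAbs F ((Matrix.GeneralLinearGroup.det (leviProjection F (id : Fin 3 → Fin 3) b 0) : Fˣ) : F)) ≠ 0 := fun h => h0 (by simpa using congrArg (fun r => r * r) h)
  generalize hs : NNReal.sqrt (normAbs F ((Matrix.GeneralLinearGroup.det (leviProjection F (id : Fin 3 → Fin 3) b 0) : Fˣ) : F)) = sA at hsA ⊢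
  rw [show normAbs F ((Matrix.GeneralLinearGroup.det (leviProjection F (id : Fin 3 → Fin 3) b 0) : Fˣ) : F) = sA * sA by rw [← hs, NNReal.mul_self_sqrt]]
  have hsA' : ((sA : ℝ) : ℂ) ≠ 0 := by exact_mod_cast hsA
  have h2' : (((normAbs F ((Matrix.GeneralLinearGroup.det (leviProjection F (id : Fin 3 → Fin 3) b 2) : Fˣ) : F)) : ℝ) : ℂ) ≠ 0 := by exact_mod_cast h2
  push_cast
  field_simp

end Scalar

/-! ## §2 Open kernels: `ψ_Q`, `tch θ`; admissibility of `D(η,ψ)` -/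

section Smooth

variable {F : Type} [Field F] [ValuativeRel F] [TopologicalSpace F] [IsNonarchimedeanLocalField F]

/-- The kernel of a product of two characters with open kernels is open (it contains the intersection). [cite: BernsteinZelevinsky1977, §2.1] -/
theorem isOpen_ker_mul_of_isOpen {G : Type*} [Group G] [TopologicalSpace G] [ContinuousMul G] {χ χ' : G →* ℂˣ}
    (hχ : IsOpen ((χ.ker : Subgroup G) : Set G)) (hχ' : IsOpen ((χ'.ker : Subgroup G) : Set G)) :
    IsOpen (((χ * χ').ker : Subgroup G) : Set G) := by
  apply Subgroup.isOpen_mono (H₁ := χ.ker ⊓ χ'.ker)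
  · intro g hg
    rw [Subgroup.mem_inf, MonoidHom.mem_ker, MonoidHom.mem_ker] at hg
    rw [MonoidHom.mem_ker, MonoidHom.mul_apply, hg.1, hg.2, one_mul]
  · exact hχ.inter hχ'

/-- The kernel of `χ⁻¹` is the kernel of `χ`. [cite: BernsteinZelevinsky1977, §2.1] -/
theorem ker_inv_eq_ker {G : Type*} [Group G] (χ : G →* ℂˣ) : (χ⁻¹).ker = χ.ker := by
  ext g
  simp only [MonoidHom.mem_ker, MonoidHom.inv_apply, inv_eq_one]

/-- `ker (χ ∘ det ∘ ev_a)` is open in a finite product of general linear groups over `F` when `ker χ ≤ F^×` is open (`det` and evaluation are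
continuous). [cite: BernsteinZelevinsky1977, §2.1] -/
theorem isOpen_ker_comp_det_eval {α : Type*} {m : α → Type*} [∀ a, Fintype (m a)] [∀ a, DecidableEq (m a)] (χ : Fˣ →* ℂˣ)
    (hχ : IsOpen ((χ.ker : Subgroup Fˣ) : Set Fˣ)) (a : α) :
    IsOpen (((χ.comp (Matrix.GeneralLinearGroup.det.comp (Pi.evalMonoidHom (fun a => GL (m a) F) a))).ker : Subgroup (Π a, GL (m a) F)) :
      Set (Π a, GL (m a) F)) := by
  haveI : IsTopologicalRing F := inferInstance
  have h : (((χ.comp (Matrix.GeneralLinearGroup.det.comp (Pi.evalMonoidHom (fun a => GL (m a) F) a))).ker : Subgroup (Π a, GL (m a) F)) :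
      Set (Π a, GL (m a) F)) = (fun g : (Π a, GL (m a) F) => Matrix.GeneralLinearGroup.det (g a)) ⁻¹' ((χ.ker : Subgroup Fˣ) : Set Fˣ) := by
    ext g
    simp only [SetLike.mem_coe, MonoidHom.mem_ker, MonoidHom.coe_comp, Function.comp_apply, Pi.evalMonoidHom_apply, Set.mem_preimage]
  rw [h]
  exact hχ.preimage (Matrix.GeneralLinearGroup.continuous_det.comp (continuous_apply a))

variable (η ψ : Fˣ →* ℂˣ)

/-- **`ker ψ_Q ≤ M_Q` is open** for `ψ_Q = (η ∘ det ∘ ev_false) · (ψ ∘ det ∘ ev_true)` when `ker η`, `ker ψ` are open — architect's (i). [cite: BernsteinZelevinsky1977, §2.3] -/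
theorem isOpen_ker_psiQ (hη : IsOpen ((η.ker : Subgroup Fˣ) : Set Fˣ)) (hψ : IsOpen ((ψ.ker : Subgroup Fˣ) : Set Fˣ)) :
    IsOpen (((((η.comp (Matrix.GeneralLinearGroup.det.comp (Pi.evalMonoidHom (fun a : Bool => GL {i : Fin 3 // (![false, false, true] : Fin 3 → Bool) i = a} F) false))) * (ψ.comp (Matrix.GeneralLinearGroup.det.comp (Pi.evalMonoidHom (fun a : Bool => GL {i : Fin 3 // (![false, false, true] : Fin 3 → Bool) i = a} F) true))))).ker : Subgroup (Π a : Bool, GL {i : Fin 3 // (![false, false, true] : Fin 3 → Bool) i = a} F)) : Set (Π a : Bool, GL {i : Fin 3 // (![false, false, true] : Fin 3 → Bool) i = a} F)) :=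
  isOpen_ker_mul_of_isOpen (isOpen_ker_comp_det_eval η hη false) (isOpen_ker_comp_det_eval ψ hψ true)

/-- **`D(η,ψ) = Ind_{P₂₁}((η∘det₂ ⊠ ψ) δ^{1∕2})` IS ADMISSIBLE** (★ `isAdmissible_parabolicIndGL` applied to the admissible character `ψ_Q` of `M_Q`) —
architect's (i). [cite: BernsteinZelevinsky1977, Prop. 2.3] -/
theorem isAdmissible_D (hη : IsOpen ((η.ker : Subgroup Fˣ) : Set Fˣ)) (hψ : IsOpen ((ψ.ker : Subgroup Fˣ) : Set Fˣ)) :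
    (Representation.parabolicIndGL F (![false, false, true] : Fin 3 → Bool) ((Representation.trivial ℂ (Π a : Bool, GL {i : Fin 3 // (![false, false, true] : Fin 3 → Bool) i = a} F) ℂ).twist ((η.comp (Matrix.GeneralLinearGroup.det.comp (Pi.evalMonoidHom (fun a : Bool => GL {i : Fin 3 // (![false, false, true] : Fin 3 → Bool) i = a} F) false))) * (ψ.comp (Matrix.GeneralLinearGroup.det.comp (Pi.evalMonoidHom (fun a : Bool => GL {i : Fin 3 // (![false, false, true] : Fin 3 → Bool) i = a} F) true)))))).IsAdmissible :=
  Representation.isAdmissible_parabolicIndGL_holds F (![false, false, true] : Fin 3 → Bool) _ (isAdmissible_trivial_twist (isOpen_ker_psiQ η ψ hη hψ))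

omit η ψ in
/-- **`ker (tch θ) ≤ T` is open** when the three characters `θ a` have open kernels. [cite: BernsteinZelevinsky1977, §2.3] -/
theorem isOpen_ker_tch (θ : Fin 3 → (Fˣ →* ℂˣ)) (hθ : ∀ a, IsOpen (((θ a).ker : Subgroup Fˣ) : Set Fˣ)) :
    IsOpen ((((∏ a : Fin 3, (θ a).comp (Matrix.GeneralLinearGroup.det.comp (Pi.evalMonoidHom (fun a : Fin 3 => GL {i : Fin 3 // (id : Fin 3 → Fin 3) i = a} F) a)))).ker : Subgroup (Π a : Fin 3, GL {i : Fin 3 // (id : Fin 3 → Fin 3) i = a} F)) : Set (Π a : Fin 3, GL {i : Fin 3 // (id : Fin 3 → Fin 3) i = a} F)) := by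
  rw [Fin.prod_univ_three]
  exact isOpen_ker_mul_of_isOpen (isOpen_ker_mul_of_isOpen (isOpen_ker_comp_det_eval _ (hθ 0) 0) (isOpen_ker_comp_det_eval _ (hθ 1) 1))
    (isOpen_ker_comp_det_eval _ (hθ 2) 2)

/-- `ker ν½` is open (`ν½ = ‖·‖^{1∕2}` is a quasi-character, ★ `isOpen_ker_quasiChar`). [cite: BushnellHenniart2006, §1.5] -/
theorem isOpen_ker_nuHalf : IsOpen (((((unramifiedTwist F (1 / 2) : QuasiChar F).toMonoidHom)).ker : Subgroup Fˣ) : Set Fˣ) :=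
  isOpen_ker_quasiChar_holds (F := F) (unramifiedTwist F (1 / 2))

/-- The three characters `ην^{-1∕2}, ην^{1∕2}, ψ` have open kernels. [cite: BernsteinZelevinsky1977, §2.3] -/
theorem isOpen_ker_theta (hη : IsOpen ((η.ker : Subgroup Fˣ) : Set Fˣ)) (hψ : IsOpen ((ψ.ker : Subgroup Fˣ) : Set Fˣ)) (a : Fin 3) :
    IsOpen ((((![η * ((unramifiedTwist F (1 / 2) : QuasiChar F).toMonoidHom)⁻¹, η * ((unramifiedTwist F (1 / 2) : QuasiChar F).toMonoidHom), ψ] : Fin 3 → (Fˣ →* ℂˣ)) a).ker : Subgroup Fˣ) : Set Fˣ) := by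
  fin_cases a
  · exact isOpen_ker_mul_of_isOpen hη (by rw [ker_inv_eq_ker]; exact isOpen_ker_nuHalf)
  · exact isOpen_ker_mul_of_isOpen hη isOpen_ker_nuHalf
  · exact hψ

/-- The inducing representation `(𝟙 ⊗ tch θ) ∘ proj_B ⊗ δ_B^{1∕2}` of `I(θ)` is smooth. [cite: BernsteinZelevinsky1977, §1.8, §2.3] -/
theorem isSmooth_inducing (hη : IsOpen ((η.ker : Subgroup Fˣ) : Set Fˣ)) (hψ : IsOpen ((ψ.ker : Subgroup Fˣ) : Set Fˣ)) :
    (Representation.twist (((Representation.trivial ℂ (Π a : Fin 3, GL {i : Fin 3 // (id : Fin 3 → Fin 3) i = a} F) ℂ).twist (∏ a : Fin 3, ((![η * ((unramifiedTwist F (1 / 2) : QuasiChar F).toMonoidHom)⁻¹, η * ((unramifiedTwist F (1 / 2) : QuasiChar F).toMonoidHom), ψ] : Fin 3 → (Fˣ →* ℂˣ)) a).comp (Matrix.GeneralLinearGroup.det.comp (Pi.evalMonoidHom (fun a : Fin 3 => GL {i : Fin 3 // (id : Fin 3 → Fin 3) i = a} F) a)))).comp (leviProjection F (id : Fin 3 →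 Fin 3))) (rootDeltaChar (standardParabolicGL F (id : Fin 3 → Fin 3)))).IsSmooth :=
  (isSmooth_trivial_twist (isOpen_ker_tch _ (isOpen_ker_theta η ψ hη hψ))).twist_comp_leviProjection

end Smooth

/-! ## §3 `D(η,ψ)` is left-invariant under the unipotent `u₁₀(x)` of the Levi `GL₂` -/

section Invariance

variable {F : Type} [Field F]

/-- `u₁₀(x) ∈ P₂₁` (it lies in the Levi `GL₂`-block). [cite: BernsteinZelevinsky1977, §2.1] -/
theorem transvectionUnit_one_zero_mem (x : F) :
    transvectionUnit (n := 3) 1 0 (by decide) x ∈ standardParabolicGL F (![false, false, true] : Fin 3 → Bool) := by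
  rw [mem_standardParabolicGL_iff]
  intro i j hij
  have hne : i ≠ j := by rintro rfl; exact lt_irrefl _ hij
  rw [K2E3GL3MaximalParabolicRelabel.transvectionUnit_apply, Matrix.one_apply_ne hne, zero_add, if_neg]
  rintro ⟨rfl, rfl⟩
  revert hij
  decide

/-- `det u₁₀(x) = 1`. [folklore] -/
theorem det_transvectionUnit_one_zero (x : F) : Matrix.GeneralLinearGroup.det (transvectionUnit (n := 3) 1 0 (by decide) x) = 1 :=
  Units.ext (by rw [Matrix.GeneralLinearGroup.val_det_apply, coe_transvectionUnit, ← Matrix.transvection, Matrix.det_transvection_of_ne _ _ (by decide),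
    Units.val_one])

/-- The `GL₁`-block of `u₁₀(x)` is `1`. [cite: BernsteinZelevinsky1977, §2.1] -/
theorem det_leviProjection_transvectionUnit_true (x : F) :
    Matrix.GeneralLinearGroup.det (leviProjection F (![false, false, true] : Fin 3 → Bool) ⟨transvectionUnit (n := 3) 1 0 (by decide) x,
      transvectionUnit_one_zero_mem x⟩ true) = 1 := by
  apply Units.ext
  rw [det_leviProjection_twoOne_true, Units.val_one]
  change ((transvectionUnit (n := 3) 1 0 (by decide) x : GL (Fin 3) F) : Matrix (Fin 3) (Fin 3) F) 2 2 = 1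
  rw [K2E3GL3MaximalParabolicRelabel.transvectionUnit_apply, Matrix.one_apply_eq, if_neg (by decide), add_zero]

/-- The `GL₂`-block of `u₁₀(x)` has determinant `1`. [cite: BernsteinZelevinsky1977, §2.1] -/
theorem det_leviProjection_transvectionUnit_false (x : F) :
    Matrix.GeneralLinearGroup.det (leviProjection F (![false, false, true] : Fin 3 → Bool) ⟨transvectionUnit (n := 3) 1 0 (by decide) x,
      transvectionUnit_one_zero_mem x⟩ false) = 1 := by
  have h := det_leviProjection_false_mul_true (⟨transvectionUnit (n := 3) 1 0 (by decide) x, transvectionUnit_one_zero_mem x⟩ :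
    ↥(standardParabolicGL F (![false, false, true] : Fin 3 → Bool)))
  rwa [det_leviProjection_transvectionUnit_true, mul_one, Subgroup.coe_mk, det_transvectionUnit_one_zero] at h

variable [ValuativeRel F] [TopologicalSpace F] [IsNonarchimedeanLocalField F] (η ψ : Fˣ →* ℂˣ)

/-- **`f(u₁₀(x) g) = f(g)` for `f ∈ D(η,ψ)`**: the inducing datum `δ_{P₂₁}^{1∕2} · ψ_Q ∘ proj` is trivial on the unipotent `u₁₀(x)` of the Levi
`GL₂` (`det = 1` on both blocks; ★ `rootDeltaChar_eq_one_of_transvectionUnit`). [cite: BernsteinZelevinsky1977, 1.7, §2.3] -/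
theorem toFun_transvectionUnit_one_zero_mul
    (f : Representation.SmoothInd (standardParabolicGL F (![false, false, true] : Fin 3 → Bool))
      (Representation.twist (((Representation.trivial ℂ (Π a : Bool, GL {i : Fin 3 // (![false, false, true] : Fin 3 → Bool) i = a} F) ℂ).twist ((η.comp (Matrix.GeneralLinearGroup.det.comp (Pi.evalMonoidHom (fun a : Bool => GL {i : Fin 3 // (![false, false, true] : Fin 3 → Bool) i = a} F) false))) * (ψ.comp (Matrix.GeneralLinearGroup.det.comp (Pi.evalMonoidHom (fun a : Bool => GL {i : Fin 3 // (![false, false, true] : Fin 3 → Bool) i = a} F) true))))).comp (leviProjection F (![false, false, true] : Fin 3 → Bool))) (rootDeltaChar (standardParabolicGL F (![false, false, true] : Fin 3 → Bool)))))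
    (x : F) (g : GL (Fin 3) F) : f.toFun (transvectionUnit (n := 3) 1 0 (by decide) x * g) = f.toFun g := by
  haveI : IsTopologicalRing F := inferInstance
  have hδ := K2E3GL3CuspidalBlockRestriction.rootDeltaChar_eq_one_of_transvectionUnit F (P := (standardParabolicGL F (![false, false, true] : Fin 3 → Bool))) (i := 1) (j := 0) (by decide)
    (fun z => transvectionUnit_one_zero_mem z) x
  refine (f.toFun_subgroup_mul ⟨transvectionUnit (n := 3) 1 0 (by decide) x, transvectionUnit_one_zero_mem x⟩ g).trans ?_
  simp only [Representation.twist_apply, MonoidHom.coe_comp, Function.comp_apply, Representation.trivial_apply, MonoidHom.mul_apply,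
    Pi.evalMonoidHom_apply, hδ, det_leviProjection_transvectionUnit_true,
    det_leviProjection_transvectionUnit_false, map_one, one_mul, Units.val_one, one_smul]

end Invariance

/-! ## §4 The embedding `Φ : D(η,ψ) ↪ I(ην^{-1∕2}, ην^{1∕2}, ψ)`, injective and not surjective -/

section Main

variable {F : Type} [Field F] [ValuativeRel F] [TopologicalSpace F] [IsNonarchimedeanLocalField F] (η ψ : Fˣ →* ℂˣ)

/-- **BRICK STD-EMB — THE STANDARD MODULE EMBEDS PROPERLY INTO THE PRINCIPAL SERIES.**  For characters `η, ψ` of `F^×` with open kernels there is a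
`GL₃(F)`-intertwining map `Φ : D(η,ψ) = Ind_{P₂₁}((η∘det₂ ⊠ ψ) δ_{P₂₁}^{1∕2}) → I(ην^{-1∕2}, ην^{1∕2}, ψ)` which is INJECTIVE, NOT SURJECTIVE, and is
the identity on functions: `(Φ f)(g) = f(g)`.  (`B ≤ P₂₁` and the two inducing characters agree on `B`, `inducing_scalar_borel_eq`; Frobenius reciprocity
★ `frobeniusInv`; non-surjectivity by the open-cell section `Φ_{K,1}`, `toFun_transvectionUnit_one_zero_mul` versus `toFun_cellSection_w₀`.)
[cite: BernsteinZelevinsky1977, Prop. 1.9, §2.3] [cite: Zelevinsky1980, Prop. 2.10, Ex. 3.2] [cite: BernsteinZelevinskyRMS1976, §2.22] -/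
theorem exists_injective_not_surjective_intertwiningMap (hη : IsOpen ((η.ker : Subgroup Fˣ) : Set Fˣ)) (hψ : IsOpen ((ψ.ker : Subgroup Fˣ) : Set Fˣ)) :
    ∃ Φ : (Representation.parabolicIndGL F (![false, false, true] : Fin 3 → Bool) ((Representation.trivial ℂ (Π a : Bool, GL {i : Fin 3 // (![false, false, true] : Fin 3 → Bool) i = a} F) ℂ).twist ((η.comp (Matrix.GeneralLinearGroup.det.comp (Pi.evalMonoidHom (fun a : Bool => GL {i : Fin 3 // (![false, false, true] : Fin 3 → Bool) i = a} F) false))) * (ψ.comp (Matrix.GeneralLinearGroup.det.comp (Pi.evalMonoidHom (fun a : Bool => GL {i : Fin 3 // (![false, false, true] : Fin 3 → Bool) i = a} F) true)))))).IntertwiningMap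
        (Representation.parabolicIndGL F (id : Fin 3 → Fin 3) ((Representation.trivial ℂ (Π a : Fin 3, GL {i : Fin 3 // (id : Fin 3 → Fin 3) i = a} F) ℂ).twist (∏ a : Fin 3, ((![η * ((unramifiedTwist F (1 / 2) : QuasiChar F).toMonoidHom)⁻¹, η * ((unramifiedTwist F (1 / 2) : QuasiChar F).toMonoidHom), ψ] : Fin 3 → (Fˣ →* ℂˣ)) a).comp (Matrix.GeneralLinearGroup.det.comp (Pi.evalMonoidHom (fun a : Fin 3 => GL {i : Fin 3 // (id : Fin 3 → Fin 3) i = a} F) a))))),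
      Function.Injective Φ ∧ ¬ Function.Surjective Φ ∧ ∀ f g, (Φ f).toFun g = f.toFun g := by
  classical
  have hBQ : ∀ b : ↥(standardParabolicGL F (id : Fin 3 → Fin 3)), (b : GL (Fin 3) F) ∈ standardParabolicGL F (![false, false, true] : Fin 3 → Bool) :=
    fun b => borel_le_standardParabolicGL monotone_twoOne b.2
  -- the `B`-map `Φ₀ : f ↦ f(1)` from `D(η,ψ)|_B` to the inducing character `χ₃` of `I(θ)`
  let Φ₀ : Representation.IntertwiningMap ((Representation.parabolicIndGL F (![false, false, true] : Fin 3 → Bool) ((Representation.trivial ℂ (Π a : Bool, GL {i : Fin 3 // (![false, false, true] : Fin 3 → Bool) i = a} F) ℂ).twist ((η.comp (Matrix.GeneralLinearGroup.det.comp (Pi.evalMonoidHom (fun a : Bool => GL {i : Fin 3 // (![false, false, true] : Fin 3 → Bool) i = a} F) false))) * (ψ.comp (Matrix.GeneralLinearGroup.det.comp (Pi.evalMonoidHom (fun a : Bool => GL {i : Fin 3 // (![false, false, true] : Fin 3 → Bool) i = a} F) true)))))).comp (standardParabolicGL F (id : Fin 3 → Fin 3)).subtype) (Representation.twist (((Representation.trivial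 ℂ (Π a : Fin 3, GL {i : Fin 3 // (id : Fin 3 → Fin 3) i = a} F) ℂ).twist (∏ a : Fin 3, ((![η * ((unramifiedTwist F (1 / 2) : QuasiChar F).toMonoidHom)⁻¹, η * ((unramifiedTwist F (1 / 2) : QuasiChar F).toMonoidHom), ψ] : Fin 3 → (Fˣ →* ℂˣ)) a).comp (Matrix.GeneralLinearGroup.det.comp (Pi.evalMonoidHom (fun a : Fin 3 => GL {i : Fin 3 // (id : Fin 3 → Fin 3) i = a} F) a)))).comp (leviProjection F (id : Fin 3 → Fin 3))) (rootDeltaChar (standardParabolicGL F (id : Fin 3 → Fin 3)))) :=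
    { toFun := fun f => f.toFun 1
      map_add' := fun f₁ f₂ => by
        simp only [Representation.SmoothInd.toFun_add, Pi.add_apply]
      map_smul' := fun c f => by
        simp only [Representation.SmoothInd.toFun_smul, Pi.smul_apply, RingHom.id_apply]
      isIntertwining' := fun b => by
        refine LinearMap.ext fun f => ?_
        simp only [LinearMap.coe_comp, Function.comp_apply, LinearMap.coe_mk, AddHom.coe_mk, MonoidHom.coe_comp, Subgroup.coe_subtype]
        rw [toFun_parabolicIndGL_apply, one_mul, toFun_eq_apply_toFun_one f (hBQ b)]
        simp only [Representation.twist_apply, MonoidHom.coe_comp, Function.comp_apply, Representation.trivial_apply, smul_eq_mul]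
        exact inducing_scalar_borel_eq η ψ b _ }
  have hΦ₀ : ∀ f, Φ₀ f = f.toFun 1 := fun _ => rfl
  clear_value Φ₀
  have hsm : (Representation.parabolicIndGL F (![false, false, true] : Fin 3 → Bool) ((Representation.trivial ℂ (Π a : Bool, GL {i : Fin 3 // (![false, false, true] : Fin 3 → Bool) i = a} F) ℂ).twist ((η.comp (Matrix.GeneralLinearGroup.det.comp (Pi.evalMonoidHom (fun a : Bool => GL {i : Fin 3 // (![false, false, true] : Fin 3 → Bool) i = a} F) false))) * (ψ.comp (Matrix.GeneralLinearGroup.det.comp (Pi.evalMonoidHom (fun a : Bool => GL {i : Fin 3 // (![false, false, true] : Fin 3 → Bool) i = a} F) true)))))).IsSmooth := Representation.isSmooth_smoothInd _ _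
  have hform : ∀ f g, (Representation.frobeniusInv (H := (standardParabolicGL F (id : Fin 3 → Fin 3))) hsm Φ₀ f).toFun g = f.toFun g := by
    intro f g
    rw [Representation.toFun_frobeniusInv_apply, hΦ₀, toFun_parabolicIndGL_apply, one_mul]
  refine ⟨Representation.frobeniusInv (H := (standardParabolicGL F (id : Fin 3 → Fin 3))) hsm Φ₀, fun f₁ f₂ hf => ?_, ?_, hform⟩
  · refine Representation.SmoothInd.ext (funext fun g => ?_)
    have h := congrArg (fun φ : Representation.SmoothInd _ _ => φ.toFun g) hf
    exact (hform f₁ g).symm.trans (h.trans (hform f₂ g))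
  · -- NOT SURJECTIVE: the open-cell section `Φ_{K,1} ∈ I(θ)` (`K = N' ∩ K_1`) is not left-`u₁₀`-invariant
    intro hsurj
    haveI : IsTopologicalRing F := inferInstance
    have hσ' := isSmooth_inducing η ψ hη hψ
    obtain ⟨ϖ, hϖ⟩ := exists_isUniformizer F
    have hϖv : valuation F (ϖ : F) = unifValue F := hϖ
    obtain ⟨f, hf⟩ := hsurj (cellSection (Representation.twist (((Representation.trivial ℂ (Π a : Fin 3, GL {i : Fin 3 // (id : Fin 3 → Fin 3) i = a} F) ℂ).twist (∏ a : Fin 3, ((![η * ((unramifiedTwist F (1 / 2) : QuasiChar F).toMonoidHom)⁻¹, η * ((unramifiedTwist F (1 / 2) : QuasiChar F).toMonoidHom), ψ] : Fin 3 → (Fˣ →* ℂˣ)) a).comp (Matrix.GeneralLinearGroup.det.comp (Pi.evalMonoidHom (fun a : Fin 3 => GL {i : Fin 3 // (id : Fin 3 → Fin 3) i = a} F) a)))).comp (leviProjection F (id : Fin 3 → Fin 3))) (rootDeltaChar (standardParabolicGL F (id : Fin 3 → Fin 3))))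
      monotone_id hσ' ((congruenceGL 3 (1 : ValueGroupWithZero F)).comap (oppositeCellRadical (K := F) (id : Fin 3 → Fin 3)).subtype)
      (isOpen_comap_congruenceGL_oppositeCellRadical (id : Fin 3 → Fin 3) one_ne_zero)
      (isCompact_comap_congruenceGL_oppositeCellRadical (id : Fin 3 → Fin 3) 1) (1 : ℂ))
    -- `u₁₀(ϖ⁻¹) w₀ = 1 · w₀ · u₁₂(ϖ⁻¹)` with `u₁₂(ϖ⁻¹) ∈ N'` outside `K_1`
    have hu : transvectionUnit (n := 3) 1 0 (by decide) (((ϖ⁻¹ : Fˣ) : F)) * permGL Fin.revPerm =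
        1 * permGL Fin.revPerm * transvectionUnit (n := 3) 1 2 (by decide) (((ϖ⁻¹ : Fˣ) : F)) := by
      rw [one_mul, ← K2E3GL3MaximalParabolicRelabel.permGL_rev_mul_transvectionUnit_one_two_mul_inv, inv_mul_cancel_right]
    have hn' : transvectionUnit (n := 3) 1 2 (by decide) (((ϖ⁻¹ : Fˣ) : F)) ∈ oppositeCellRadical (K := F) (id : Fin 3 → Fin 3) := by
      change _ ∈ unipotentRadicalGL F (⇑OrderDual.toDual ∘ revLabel (id : Fin 3 → Fin 3))
      rw [mem_unipotentRadicalGL_iff_apply]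
      intro i j hij
      rw [K2E3GL3MaximalParabolicRelabel.transvectionUnit_apply, add_eq_left, if_neg]
      rintro ⟨rfl, rfl⟩
      simp only [Function.comp_apply, OrderDual.toDual_le_toDual, revLabel, id] at hij
      exact absurd hij (by decide)
    have hnotK : (⟨_, hn'⟩ : ↥(oppositeCellRadical (K := F) (id : Fin 3 → Fin 3))) ∉
        (((congruenceGL 3 (1 : ValueGroupWithZero F)).comap (oppositeCellRadical (K := F) (id : Fin 3 → Fin 3)).subtype :
          Subgroup ↥(oppositeCellRadical (K := F) (id : Fin 3 → Fin 3))) : Set ↥(oppositeCellRadical (K := F) (id : Fin 3 → Fin 3))) := by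
      intro hK
      rw [SetLike.mem_coe, Subgroup.mem_comap, Subgroup.coe_subtype, mem_congruenceGL_iff] at hK
      have h12 := hK.1.1 1 2
      rw [K2E3GL3MaximalParabolicRelabel.transvectionUnit_apply, Matrix.one_apply_ne (by decide), zero_add, if_pos ⟨rfl, rfl⟩,
        Units.val_inv_eq_inv_val, map_inv₀, hϖv, inv_le_one₀ (zero_lt_iff.2 (unifValue_ne_zero F))] at h12
      exact absurd h12 (not_le.2 (unifValue_lt_one F))
    have h0 : (cellSection (Representation.twist (((Representation.trivial ℂ (Π a : Fin 3, GL {i : Fin 3 // (id : Fin 3 → Fin 3) i = a} F) ℂ).twist (∏ a : Fin 3, ((![η * ((unramifiedTwist F (1 / 2) : QuasiChar F).toMonoidHom)⁻¹, η * ((unramifiedTwist F (1 / 2) : QuasiChar F).toMonoidHom), ψ] : Fin 3 → (Fˣ →* ℂˣ)) a).comp (Matrix.GeneralLinearGroup.det.comp (Pi.evalMonoidHom (fun a : Fin 3 => GL {i : Fin 3 // (id : Fin 3 → Fin 3) i = a} F) a)))).comp (leviProjection F (id : Fin 3 → Fin 3))) (rootDeltaChar (standardParabolicGL F (id : Fin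 3 → Fin 3))))
        monotone_id hσ' ((congruenceGL 3 (1 : ValueGroupWithZero F)).comap (oppositeCellRadical (K := F) (id : Fin 3 → Fin 3)).subtype)
        (isOpen_comap_congruenceGL_oppositeCellRadical (id : Fin 3 → Fin 3) one_ne_zero)
        (isCompact_comap_congruenceGL_oppositeCellRadical (id : Fin 3 → Fin 3) 1) (1 : ℂ)).toFun
          (transvectionUnit (n := 3) 1 0 (by decide) (((ϖ⁻¹ : Fˣ) : F)) * permGL Fin.revPerm) = 0 := by
      rw [toFun_cellSection, hu]
      exact cellSectionFun_eq_zero_of_not_mem monotone_id (1 : ℂ) (Subgroup.one_mem _) hn' hnotK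
    -- `f(w₀) = Φ_{K,1}(w₀) = 1` but `f(w₀) = f(u₁₀ w₀) = Φ_{K,1}(u₁₀ w₀) = 0`
    have e1 : f.toFun (permGL Fin.revPerm) = 1 :=
      (hform f _).symm.trans (((congrArg (fun φ : Representation.SmoothInd _ _ => φ.toFun (permGL Fin.revPerm)) hf)).trans
        (toFun_cellSection_w₀ _ monotone_id hσ' _ _ _ (1 : ℂ)))
    have e2 : f.toFun (transvectionUnit (n := 3) 1 0 (by decide) (((ϖ⁻¹ : Fˣ) : F)) * permGL Fin.revPerm) = 0 :=
      (hform f _).symm.trans (((congrArg (fun φ : Representation.SmoothInd _ _ =>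
        φ.toFun (transvectionUnit (n := 3) 1 0 (by decide) (((ϖ⁻¹ : Fˣ) : F)) * permGL Fin.revPerm)) hf)).trans h0)
    rw [toFun_transvectionUnit_one_zero_mul, e1] at e2
    exact one_ne_zero e2

end Main

end Summit.HodgeConjecture.HodgeConjecture.Cruxes.H413.K2E3GL3StandardModuleEmbedding

end
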